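import Mathlib
import HarnessLib
import Summits.NavierStokesRegularity.NavierStokesRegularity.Theorems.SubOnsagerCeilingKPSideBranchClassDynamics
import Summits.NavierStokesRegularity.NavierStokesRegularity.Theorems.SubOnsagerCeilingKPDissipationRange

/-!
# The dissipation range of the viscous Katz–Pavlović chain: beyond one sub-Kolmogorov shell every barrier holds
# (helper file for the crux `SubOnsagerCeiling.ForwardTailCeilingKP`, stmt-NavierStokesRegularity-27057, `--supports`)

Chain format VERBATIM that of the LEAD's chain rungs and of `Theorems/SubOnsagerCeilingKPChainPeak.lean`: an honest solution
`Z_k : [0,s] → ℝ` (`k ≥ -1`, `Z_{-1} ≡ 0`) of `Ż_k = c₀ (b^{5(k-1)/2} Z_{k-1}² − b^{5k/2} Z_k Z_{k+1}) − ν b^{2k} Z_k` from the one-shell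
datum `Z_k(0) = x₀ 1_{k=0}`, non-negative on `[0,s]`.

* `kpChainDiss_sup_le` — **one dissipation step**: if `0 ≤ Z_k ≤ M_k` on `[0,s]`, then
  `Z_{k+1} ≤ c₀ b^{5k/2} M_k² / (ν b^{2(k+1)})` on `[0,s]` (drop the non-positive drain, then the tree's linear slaving lemma
  `Theorems.linearSlaving_le` for `x' ≤ I₀ − κ x`, `x(0) = 0`);
* `kpChainDiss_recursion` — for ATTAINED running peaks `M_k = Z_k(t_k) = max_{[0,s]} Z_k` this is the dissipation-range recursion
  `M_{k+1} ≤ A r^k M_k²` with `A = c₀/(ν b²)`, `r = b^{1/2}`;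
* `kpChainDiss_barrier_beyond_kolmogorov` — **composite with `Theorems.kpDiss_weighted_barrier`**: if ONE shell `k₀` is
  sub-Kolmogorov, `A r^{k₀+1} M_{k₀} ≤ q < 1`, then for every weight `w > 0` (e.g. `w = b^{2θ}`, any `θ`) the weighted peaks
  `w^j M_{k₀+j}²` are bounded in `j` — the shells beyond `k₀` never obstruct a shell barrier, whatever `θ`.

So for the ν-uniform barrier of the registered stubs the whole difficulty sits at the shells BELOW the (ν-dependent) Kolmogorov
shell — the front window of the DG census (memo DG-FRONT-CENSUS-leafhand4-g2, Table A: front exponent `y ≤ 0.759 < 4/5`, which is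
also what makes a sub-Kolmogorov shell appear along the front). HONEST FRAMING: MODEL lattice ODE only (route SubOnsagerCeiling,
rung TL-M2Break); no stub, crux or summit is proved here and nothing in this file bears on Navier–Stokes regularity.
[cite: BarbatoMorandinRomito2011, §3.2] [cite: Tao2016AveragedNS, §4 (4.13)]
-/

noncomputable section

-- the sub-problem namespace `NavierStokesRegularity.NavierStokesRegularity` is the tree's layout (D-0017)
set_option linter.dupNamespace false

namespace Summit.NavierStokesRegularity.NavierStokesRegularity.Theorems.KPChainDiss

open Set

/-- **One dissipation step.** Along an honest non-negative solution of the viscous chain from the one-shell datum, if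
`Z_k ≤ M_k` on `[0,s]` then `Z_{k+1} ≤ c₀ b^{5k/2} M_k² / (ν b^{2(k+1)})` on `[0,s]`: the drain `−c₀ b^{5(k+1)/2} Z_{k+1} Z_{k+2}`
is non-positive, the feed is at most `c₀ b^{5k/2} M_k²`, and `x' ≤ I₀ − κ x`, `x(0) = 0 ≤ I₀/κ` forces `x ≤ I₀/κ`
(`Theorems.linearSlaving_le`). [cite: BarbatoMorandinRomito2011, §3.2] -/
theorem kpChainDiss_sup_le {b c₀ ν s x₀ : ℝ} (hb : 0 < b) (hc₀ : 0 ≤ c₀) (hν : 0 < ν) {Z : ℤ → ℝ → ℝ}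
    (hdat : ∀ k : ℤ, Z k 0 = if k = 0 then x₀ else 0)
    (hode : ∀ k : ℕ, ∀ t ∈ Icc 0 s, HasDerivWithinAt (Z k)
      (c₀ * (b ^ ((5 : ℝ) * ((k : ℝ) - 1) / 2) * Z ((k : ℤ) - 1) t ^ 2 -
          b ^ ((5 : ℝ) * (k : ℝ) / 2) * (Z k t * Z ((k : ℤ) + 1) t)) -
        ν * b ^ ((2 : ℝ) * (k : ℝ)) * Z k t) (Icc 0 s) t)
    (hnn : ∀ k : ℕ, ∀ t ∈ Icc 0 s, 0 ≤ Z k t)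
    {k : ℕ} {Mk : ℝ} (hMk : ∀ t ∈ Icc 0 s, Z k t ≤ Mk) :
    ∀ t ∈ Icc 0 s, Z ((k : ℤ) + 1) t ≤
      c₀ * b ^ ((5 : ℝ) * (k : ℝ) / 2) * Mk ^ 2 / (ν * b ^ ((2 : ℝ) * ((k : ℝ) + 1))) := by
  have hκ : 0 < ν * b ^ ((2 : ℝ) * ((k : ℝ) + 1)) := mul_pos hν (Real.rpow_pos_of_pos hb _)
  -- the shell `k+1` as a natural-number shell
  have hidx : (((k + 1 : ℕ) : ℤ)) = (k : ℤ) + 1 := by push_cast; ring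
  have hode' : ∀ t ∈ Icc 0 s, HasDerivWithinAt (Z ((k : ℤ) + 1))
      (c₀ * (b ^ ((5 : ℝ) * (k : ℝ) / 2) * Z (k : ℤ) t ^ 2 -
          b ^ ((5 : ℝ) * ((k : ℝ) + 1) / 2) * (Z ((k : ℤ) + 1) t * Z ((k : ℤ) + 2) t)) -
        ν * b ^ ((2 : ℝ) * ((k : ℝ) + 1)) * Z ((k : ℤ) + 1) t) (Icc 0 s) t := by
    intro t ht
    have h := hode (k + 1) t ht
    rw [hidx] at h
    have e1 : (5 : ℝ) * ((((k + 1 : ℕ)) : ℝ) - 1) / 2 = (5 : ℝ) * (k : ℝ) / 2 := by push_cast; ring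
    have e2 : (5 : ℝ) * (((k + 1 : ℕ) : ℝ)) / 2 = (5 : ℝ) * ((k : ℝ) + 1) / 2 := by push_cast; ring
    have e3 : (2 : ℝ) * (((k + 1 : ℕ) : ℝ)) = (2 : ℝ) * ((k : ℝ) + 1) := by push_cast; ring
    have e4 : (k : ℤ) + 1 - 1 = (k : ℤ) := by ring
    have e5 : (k : ℤ) + 1 + 1 = (k : ℤ) + 2 := by ring
    rw [e1, e2, e3, e4, e5] at h
    exact h
  -- differential inequality `x' ≤ I₀ − κ x`
  have hineq : ∀ t ∈ Icc 0 s,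
      c₀ * (b ^ ((5 : ℝ) * (k : ℝ) / 2) * Z (k : ℤ) t ^ 2 -
          b ^ ((5 : ℝ) * ((k : ℝ) + 1) / 2) * (Z ((k : ℤ) + 1) t * Z ((k : ℤ) + 2) t)) -
        ν * b ^ ((2 : ℝ) * ((k : ℝ) + 1)) * Z ((k : ℤ) + 1) t ≤
      c₀ * b ^ ((5 : ℝ) * (k : ℝ) / 2) * Mk ^ 2 -
        ν * b ^ ((2 : ℝ) * ((k : ℝ) + 1)) * Z ((k : ℤ) + 1) t := by
    intro t ht
    have hz0 : 0 ≤ Z (k : ℤ) t := hnn k t ht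
    have hz1 : 0 ≤ Z ((k : ℤ) + 1) t := by
      have := hnn (k + 1) t ht; rwa [hidx] at this
    have hz2 : 0 ≤ Z ((k : ℤ) + 2) t := by
      have := hnn (k + 2) t ht
      have e : (((k + 2 : ℕ) : ℤ)) = (k : ℤ) + 2 := by push_cast; ring
      rwa [e] at this
    have hsq : Z (k : ℤ) t ^ 2 ≤ Mk ^ 2 := pow_le_pow_left₀ hz0 (hMk t ht) 2
    have hp5 : 0 ≤ b ^ ((5 : ℝ) * (k : ℝ) / 2) := (Real.rpow_pos_of_pos hb _).le
    have hp5' : 0 ≤ b ^ ((5 : ℝ) * ((k : ℝ) + 1) / 2) := (Real.rpow_pos_of_pos hb _).le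
    have hdrain : 0 ≤ b ^ ((5 : ℝ) * ((k : ℝ) + 1) / 2) * (Z ((k : ℤ) + 1) t * Z ((k : ℤ) + 2) t) :=
      mul_nonneg hp5' (mul_nonneg hz1 hz2)
    have hfeed : c₀ * (b ^ ((5 : ℝ) * (k : ℝ) / 2) * Z (k : ℤ) t ^ 2) ≤ c₀ * (b ^ ((5 : ℝ) * (k : ℝ) / 2) * Mk ^ 2) :=
      mul_le_mul_of_nonneg_left (mul_le_mul_of_nonneg_left hsq hp5) hc₀
    nlinarith
  have hinit : Z ((k : ℤ) + 1) 0 ≤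
      c₀ * b ^ ((5 : ℝ) * (k : ℝ) / 2) * Mk ^ 2 / (ν * b ^ ((2 : ℝ) * ((k : ℝ) + 1))) := by
    rw [hdat]
    have hne : (k : ℤ) + 1 ≠ 0 := by omega
    rw [if_neg hne]
    positivity
  exact Summit.NavierStokesRegularity.NavierStokesRegularity.Theorems.linearSlaving_le hκ hode' hineq hinit

/-- **The dissipation-range recursion for attained peaks.** If `M : ℕ → ℝ` are the running peaks of the shells, attained
(`Z_k(t_k) = M_k`, `Z_k ≤ M_k` on `[0,s]`), then `M_{k+1} ≤ (c₀/(ν b²)) · (b^{1/2})^k · M_k²` for every `k`.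
[cite: BarbatoMorandinRomito2011, §3.2] -/
theorem kpChainDiss_recursion {b c₀ ν s x₀ : ℝ} (hb : 0 < b) (hc₀ : 0 ≤ c₀) (hν : 0 < ν) {Z : ℤ → ℝ → ℝ}
    (hdat : ∀ k : ℤ, Z k 0 = if k = 0 then x₀ else 0)
    (hode : ∀ k : ℕ, ∀ t ∈ Icc 0 s, HasDerivWithinAt (Z k)
      (c₀ * (b ^ ((5 : ℝ) * ((k : ℝ) - 1) / 2) * Z ((k : ℤ) - 1) t ^ 2 -
          b ^ ((5 : ℝ) * (k : ℝ) / 2) * (Z k t * Z ((k : ℤ) + 1) t)) -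
        ν * b ^ ((2 : ℝ) * (k : ℝ)) * Z k t) (Icc 0 s) t)
    (hnn : ∀ k : ℕ, ∀ t ∈ Icc 0 s, 0 ≤ Z k t)
    {M : ℕ → ℝ} (hMle : ∀ k : ℕ, ∀ t ∈ Icc 0 s, Z k t ≤ M k)
    (hMat : ∀ k : ℕ, ∃ t ∈ Icc 0 s, Z k t = M k) (k : ℕ) :
    M (k + 1) ≤ c₀ / (ν * b ^ 2) * (b ^ ((1 : ℝ) / 2)) ^ k * M k ^ 2 := by
  obtain ⟨t, ht, hZt⟩ := hMat (k + 1)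
  have hidx : (((k + 1 : ℕ) : ℤ)) = (k : ℤ) + 1 := by push_cast; ring
  have hstep := kpChainDiss_sup_le hb hc₀ hν hdat hode hnn (hMle k) t ht
  rw [← hidx, hZt] at hstep
  -- rewrite the constant: c₀ b^{5k/2} / (ν b^{2(k+1)}) = (c₀/(ν b²)) (b^{1/2})^k
  have hconst : c₀ * b ^ ((5 : ℝ) * (k : ℝ) / 2) * M k ^ 2 / (ν * b ^ ((2 : ℝ) * ((k : ℝ) + 1))) =
      c₀ / (ν * b ^ 2) * (b ^ ((1 : ℝ) / 2)) ^ k * M k ^ 2 := by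
    have h2 : b ^ ((2 : ℝ) * ((k : ℝ) + 1)) = b ^ 2 * b ^ ((2 : ℝ) * (k : ℝ)) := by
      rw [show (2 : ℝ) * ((k : ℝ) + 1) = 2 + 2 * (k : ℝ) by ring, Real.rpow_add hb]
      norm_num
    have h5 : b ^ ((5 : ℝ) * (k : ℝ) / 2) = (b ^ ((1 : ℝ) / 2)) ^ k * b ^ ((2 : ℝ) * (k : ℝ)) := by
      rw [← Real.rpow_natCast, ← Real.rpow_mul hb.le, ← Real.rpow_add hb]
      congr 1; ring
    have hb2 : 0 < b ^ 2 := by positivity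
    have hb2k : 0 < b ^ ((2 : ℝ) * (k : ℝ)) := Real.rpow_pos_of_pos hb _
    rw [h2, h5]
    field_simp
  rw [hconst] at hstep
  exact hstep

/-- **Beyond one sub-Kolmogorov shell every shell barrier holds.** In the situation of `kpChainDiss_recursion` with `b ≥ 1`,
`c₀ > 0`: if some shell `k₀` satisfies `A r^{k₀+1} M_{k₀} ≤ q < 1` (`A = c₀/(ν b²)`, `r = b^{1/2}`), then for every weight `w > 0`
there is `D ≥ 0` with `w^j · M_{k₀+j}² ≤ D` for all `j` (composite with `Theorems.kpDiss_weighted_barrier`). In particular, with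
`w = b^{2θ}`, the shells beyond `k₀` obey a `θ`-barrier for EVERY `θ` — the ν-uniform difficulty lives below the Kolmogorov shell.
[cite: BarbatoMorandinRomito2011, §3.2] -/
theorem kpChainDiss_barrier_beyond_kolmogorov {b c₀ ν s x₀ q w : ℝ} (hb : 1 ≤ b) (hc₀ : 0 < c₀) (hν : 0 < ν)
    (hq0 : 0 ≤ q) (hq1 : q < 1) (hw : 0 < w) {Z : ℤ → ℝ → ℝ}
    (hdat : ∀ k : ℤ, Z k 0 = if k = 0 then x₀ else 0)
    (hode : ∀ k : ℕ, ∀ t ∈ Icc 0 s, HasDerivWithinAt (Z k)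
      (c₀ * (b ^ ((5 : ℝ) * ((k : ℝ) - 1) / 2) * Z ((k : ℤ) - 1) t ^ 2 -
          b ^ ((5 : ℝ) * (k : ℝ) / 2) * (Z k t * Z ((k : ℤ) + 1) t)) -
        ν * b ^ ((2 : ℝ) * (k : ℝ)) * Z k t) (Icc 0 s) t)
    (hnn : ∀ k : ℕ, ∀ t ∈ Icc 0 s, 0 ≤ Z k t)
    {M : ℕ → ℝ} (hMle : ∀ k : ℕ, ∀ t ∈ Icc 0 s, Z k t ≤ M k)
    (hMat : ∀ k : ℕ, ∃ t ∈ Icc 0 s, Z k t = M k) {k₀ : ℕ}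
    (hK : c₀ / (ν * b ^ 2) * (b ^ ((1 : ℝ) / 2)) ^ (k₀ + 1) * M k₀ ≤ q) :
    ∃ D : ℝ, 0 ≤ D ∧ ∀ j : ℕ, w ^ j * M (k₀ + j) ^ 2 ≤ D := by
  have hb0 : 0 < b := lt_of_lt_of_le one_pos hb
  have hA : 0 < c₀ / (ν * b ^ 2) := by positivity
  have hr : 1 ≤ b ^ ((1 : ℝ) / 2) := Real.one_le_rpow hb (by norm_num)
  have hM0 : ∀ k, 0 ≤ M k := by
    intro k
    obtain ⟨t, ht, hZt⟩ := hMat k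
    rw [← hZt]; exact hnn k t ht
  have hrec : ∀ k, k₀ ≤ k → M (k + 1) ≤ c₀ / (ν * b ^ 2) * (b ^ ((1 : ℝ) / 2)) ^ k * M k ^ 2 :=
    fun k _ => kpChainDiss_recursion hb0 hc₀.le hν hdat hode hnn hMle hMat k
  exact Summit.NavierStokesRegularity.NavierStokesRegularity.Theorems.kpDiss_weighted_barrier hA hr hq0 hq1 hw hM0 hrec hK

end Summit.NavierStokesRegularity.NavierStokesRegularity.Theorems.KPChainDiss
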